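import Summits.CriticalPhenomena.SAWScalingLimit.Theorems.SAWLeftRightFKGFKGToTraversalBoundBBFourPointCore
import Summits.CriticalPhenomena.SAWScalingLimit.Theorems.SAWLeftRightFKGFKGToTraversalBoundBBRound
import HarnessLib

/-!
# Boundary budget (U6), unit BB5, part 3b: the four-point lemma (feet of facing edges are cyclically ordered)

Crux `SAWLeftRightFKG.FKGToTraversalBound` (stmt-CriticalPhenomena-1878), line `slit-necklace`, lead
prover-line-stmt-CriticalPhenomena-1878-c5-0; wave 6 (the BOUNDARY BUDGET), unit BB5, part 3b = the registered stub
`bb_four_point`, on top of `…BBFourPointCore` (`bbp_core`: no two disjoint exterior connectors between alternating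
feet) and the sibling `…BBRound` (`bb_round_connectors`: disjoint exterior connectors in the round model).

* `bb_four_point` (registered) — THE PLANAR HEART of the boundary budget: for a discretised `4`-connected piece `B`
  of a Dobrushin domain `D`, four boundary edges at tour positions `P 0 < P 1 < P 2 < P 3 < P 0 + N` of one
  injective period of the wall-follower tour which FACE `∂D` with pairwise distinct feet `F i = H (e^{iθ_i})` (`H` a
  Schoenflies homeomorphism of the plane carrying the closed unit disc onto `closure D`), the angle `θ 2` lies
  strictly between `θ 1` and `θ 3` once all angles are read in `(θ 0, θ 0 + 2π)`.  Proof: otherwise the round model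
  has disjoint exterior connectors `e^{iθ 0} ⟶ e^{iθ 2}` and `e^{iθ 1} ⟶ e^{iθ 3}` (`bb_round_connectors`, in the
  two possible cyclic orders), which `H` transports to disjoint paths `F 0 ⟶ F 2`, `F 1 ⟶ F 3` outside `closure D`
  except at their ends — impossible by `bbp_core`.
* rider `bbp_transport` (a path outside the closed unit disc except at its ends is carried by `H` outside
  `closure D` except at its ends).

All statements folklore (plane topology); no literature fact is introduced; nothing restates the crux.
-/

noncomputable section

open Filter Topology Set Metric
open Literature.Probability.LatticeModels
open Literature.Probability.RandomPlanarGeometry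
open Literature.Topology.PlaneTopology

namespace Summit.CriticalPhenomena.SAWScalingLimit.Theorems.FKGToTraversalBound.SlitNecklace

/-- **Rider: transporting an exterior connector.**  A path of the plane of norm `≥ 1` which has norm `1` only at its
endpoints is carried by a homeomorphism `H` with `H '' closedBall 0 1 = closure Ω` to a path outside `closure Ω`
except where it equals the images of the endpoints. [folklore] -/
theorem bbp_transport {Ω : Set ℂ} (H : ℂ ≃ₜ ℂ) (hcl : H '' Metric.closedBall 0 1 = closure Ω) {pa pb : ℂ}
    (Pab : Path pa pb) (h1 : ∀ t, 1 ≤ ‖Pab t‖) (h2 : ∀ t, ‖Pab t‖ = 1 → Pab t = pa ∨ Pab t = pb) {Fa Fb : ℂ}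
    (ha : H pa = Fa) (hb : H pb = Fb) (t : unitInterval) :
    H (Pab t) ∉ closure Ω ∨ H (Pab t) = Fa ∨ H (Pab t) = Fb := by
  by_cases heq : ‖Pab t‖ = 1
  · rcases h2 t heq with h | h
    · exact Or.inr (Or.inl (by rw [h, ha]))
    · exact Or.inr (Or.inr (by rw [h, hb]))
  · left
    rw [← hcl, H.injective.mem_set_image]
    intro hmem
    rw [Metric.mem_closedBall, dist_zero_right] at hmem
    exact heq (le_antisymm hmem (h1 t))

/-- **Registered stub `bb_four_point` (U6, the planar heart).**  For a discretised `4`-connected piece `B` of the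
Dobrushin domain `D` at mesh `δ`, a boundary edge `e` with injective tour period `N`, four tour positions
`P 0 < P 1 < P 2 < P 3 < P 0 + N` whose edges have feet `F i` on `∂D` (first frontier points of the segments outline
site → contact site), pairwise distinct, written `F i = H (e^{iθ_i})` with a homeomorphism `H` of the plane carrying
the unit disc / circle / closed disc onto `D` / `∂D` / `closure D` and angles `θ i ∈ (θ 0, θ 0 + 2π)` (`i = 1, 2, 3`):
`θ 2` lies strictly between `θ 1` and `θ 3`. [folklore] -/
theorem bb_four_point : ∀ (D : DobrushinDomain) (δ : ℝ) (B : Finset (Site 2)) (e : Site 2 × ODir) (N : ℕ) (P : Fin 4 → ℕ) (F : Fin 4 → ℂ) (H : ℂ ≃ₜ ℂ) (θ : Fin 4 → ℝ), 0 < δ → (∀ x ∈ B, meshPoint δ x ∈ D.carrier) → (∀ x ∈ B, ∀ x' ∈ B, (zdGraph 2).Adj x x' → (discreteDomainGraph D.carrier δ).Adj x x') → (∀ x ∈ B, ∀ x' ∈ B, ∃ w : (zdGraph 2).Walk x x', ∀ z ∈ w.support, z ∈ B) → IsBEdge (↑B : Set (Site 2)) e → 0 < N → btour (↑B : Set (Site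 2)) e N = e → (∀ j j', j < N → j' < N → btour (↑B : Set (Site 2)) e j = btour (↑B : Set (Site 2)) e j' → j = j') → P 0 < P 1 → P 1 < P 2 → P 2 < P 3 → P 3 < P 0 + N → (∀ i, (F i ∈ frontier D.carrier ∧ F i ∈ segment ℝ (meshPoint δ (bsite (btour (↑B : Set (Site 2)) e (P i)))) (meshPoint δ (bcontact (btour (↑B : Set (Site 2)) e (P i)))) ∧ F i ≠ meshPoint δ (bsite (btour (↑B : Set (Site 2)) e (P i))) ∧ ∀ z ∈ segment ℝ (meshPoint δ (bsite (btour (↑B : Set (Site 2)) e (P i)))) (F i), z ≠ F i → z ∈ D.carrier)) → H '' Metric.ball 0 1 = D.carrier → H '' Metric.sphere 0 1 = frontier D.carrier → H '' Metric.closedBall 0 1 = closure D.carrier → Function.Injective F → (∀ i, H (circleMap 0 1 (θ i)) = F i) → θ 0 < θ 1 → θ 1 < θ 0 + 2 * Real.pi → θ 0 < θ 2 → θ 2 < θ 0 + 2 * Real.pi → θ 0 < θ 3 → θ 3 < θ 0 + 2 * Real.pi → (θ 1 < θ 2 ∧ θ 2 < θ 3) ∨ (θ 3 < θ 2 ∧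 θ 2 < θ 1) := by
  intro D δ B e N P F H θ hδ hBD hBadj hBconn he hN hper hinj h01 h12 h23 h3N hF hball hsphere hclosed hFinj hHF
    hθ1a hθ1b hθ2a hθ2b hθ3a hθ3b
  by_contra hgoal
  have hθne : ∀ i j, θ i = θ j → i = j := fun i j h => hFinj (by rw [← hHF i, ← hHF j, h])
  have hne12 : θ 1 ≠ θ 2 := fun h => absurd (hθne 1 2 h) (by decide)
  have hne23 : θ 2 ≠ θ 3 := fun h => absurd (hθne 2 3 h) (by decide)
  have hne13 : θ 1 ≠ θ 3 := fun h => absurd (hθne 1 3 h) (by decide)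
  have hper0 : circleMap 0 1 (θ 0 + 2 * Real.pi) = circleMap 0 1 (θ 0) := periodic_circleMap 0 1 (θ 0)
  have hHF0' : H (circleMap 0 1 (θ 0 + 2 * Real.pi)) = F 0 := by rw [hper0, hHF]
  have core := bbp_core D δ B e N P F
  rcases lt_or_gt_of_ne hne12 with hlt12 | hlt21 <;> rcases lt_or_gt_of_ne hne23 with hlt23 | hlt32
  · exact hgoal (Or.inl ⟨hlt12, hlt23⟩)
  · -- cyclic order `θ 0 < θ 1, θ 3 < θ 2`
    rcases lt_or_gt_of_ne hne13 with hlt13 | hlt31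
    · obtain ⟨Pp, Qq, hP1, hP2, hQ1, hQ2, hPQ⟩ := bb_round_connectors (θ 0) (θ 1) (θ 2) (θ 3) hθ1a hlt13 hlt32 hθ2b
      exact core ((Pp.map H.continuous).cast (hHF 0).symm (hHF 2).symm)
        ((Qq.map H.continuous).cast (hHF 1).symm (hHF 3).symm) hδ hBD hBadj hBconn he hN hper hinj h01 h12 h23
        h3N hF hFinj (fun t => bbp_transport H hclosed Pp hP1 hP2 (hHF 0) (hHF 2) t)
        (fun t => bbp_transport H hclosed Qq hQ1 hQ2 (hHF 1) (hHF 3) t) fun s t h => hPQ s t (H.injective h)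
    · obtain ⟨Pp, Qq, hP1, hP2, hQ1, hQ2, hPQ⟩ := bb_round_connectors (θ 0) (θ 3) (θ 2) (θ 1) hθ3a hlt31 hlt12 hθ2b
      exact core ((Pp.map H.continuous).cast (hHF 0).symm (hHF 2).symm)
        ((Qq.map H.continuous).symm.cast (hHF 1).symm (hHF 3).symm) hδ hBD hBadj hBconn he hN hper hinj h01 h12
        h23 h3N hF hFinj (fun t => bbp_transport H hclosed Pp hP1 hP2 (hHF 0) (hHF 2) t)
        (fun t => (bbp_transport H hclosed Qq hQ1 hQ2 (hHF 3) (hHF 1) (unitInterval.symm t)).imp_right Or.symm)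
        fun s t h => hPQ s (unitInterval.symm t) (H.injective h)
  · -- cyclic order `θ 0 < θ 2 < θ 1, θ 3`
    have h2π : θ 0 + 2 * Real.pi < θ 2 + 2 * Real.pi := by linarith
    rcases lt_or_gt_of_ne hne13 with hlt13 | hlt31
    · obtain ⟨Pp, Qq, hP1, hP2, hQ1, hQ2, hPQ⟩ :=
        bb_round_connectors (θ 2) (θ 1) (θ 0 + 2 * Real.pi) (θ 3) hlt21 hlt13 hθ3b h2π
      exact core ((Pp.map H.continuous).symm.cast hHF0'.symm (hHF 2).symm)
        ((Qq.map H.continuous).cast (hHF 1).symm (hHF 3).symm) hδ hBD hBadj hBconn he hN hper hinj h01 h12 h23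
        h3N hF hFinj
        (fun t => (bbp_transport H hclosed Pp hP1 hP2 (hHF 2) hHF0' (unitInterval.symm t)).imp_right Or.symm)
        (fun t => bbp_transport H hclosed Qq hQ1 hQ2 (hHF 1) (hHF 3) t)
        fun s t h => hPQ (unitInterval.symm s) t (H.injective h)
    · obtain ⟨Pp, Qq, hP1, hP2, hQ1, hQ2, hPQ⟩ :=
        bb_round_connectors (θ 2) (θ 3) (θ 0 + 2 * Real.pi) (θ 1) hlt23 hlt31 hθ1b h2π
      exact core ((Pp.map H.continuous).symm.cast hHF0'.symm (hHF 2).symm)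
        ((Qq.map H.continuous).symm.cast (hHF 1).symm (hHF 3).symm) hδ hBD hBadj hBconn he hN hper hinj h01 h12
        h23 h3N hF hFinj
        (fun t => (bbp_transport H hclosed Pp hP1 hP2 (hHF 2) hHF0' (unitInterval.symm t)).imp_right Or.symm)
        (fun t => (bbp_transport H hclosed Qq hQ1 hQ2 (hHF 3) (hHF 1) (unitInterval.symm t)).imp_right Or.symm)
        fun s t h => hPQ (unitInterval.symm s) (unitInterval.symm t) (H.injective h)
  · exact hgoal (Or.inr ⟨hlt32, hlt21⟩)

end Summit.CriticalPhenomena.SAWScalingLimit.Theorems.FKGToTraversalBound.SlitNecklace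

end
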